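import Summits.BirchSwinnertonDyer.BirchSwinnertonDyer.Theorems.ErratumRoadFiveNonSurjCornerTwinRubin
import Literature.NumberTheory.EllipticCurves.HasseWeilAbelianBadReduction

/-!
# Route `ErratumRoadFive` (rung K2a), crux 6 `NonSurjCorner` (item 19065): the EULER-UNIT CERTIFICATE
# of `Theorems/ErratumRoadFiveNonSurjCornerTwinRubin.lean` made arithmetic — `𝒫_v(0) = P_v(E, q_v⁻¹)`,
# `= 1 ∓ q_v⁻¹` at a multiplicative place, a `p`-adic unit iff `p ∤ q_v ∓ 1`
# (cell `bsd-stepL`, seat `bsd-stepL-corner-p1` g4; `--supports stmt-BirchSwinnertonDyer-19065`)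

Companion of `ErratumRoadFiveNonSurjCornerTwinRubin.lean`: there x11c's typed divisibility
`X11b.MultDivisibilityAt W p` at an odd multiplicative prime is obtained from Rubin 1998 Thm. 8.7 +
Wuthrich 2014 Cor. 18 + `μ = 0` on the locus where the augmentation `(∏_{v ∈ S} 𝒫_v)(0)` of
Greenberg–Vatsal's Euler-factor product (`GreenbergVatsal2000.eulerFactorProduct W p S`, `S ∌ (p)` a
finite set of places containing the bad places `≠ p`) is a unit of `ℤ_p`. THIS FILE computes that
augmentation (theorems only, pure algebra on the tree's definitions):

* `constantCoeff_eulerFactorElement` — `𝒫_v(0) = P_v(E, q_v⁻¹)` (`(1+T)^{f_v}` has constant term `1`);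
* `constantCoeff_eulerFactorElement_of_split ∕ _of_nonsplit ∕ _of_additive` — `= 1 - q_v⁻¹`,
  `1 + q_v⁻¹`, `1` by reduction type (`P_v = 1 - X`, `1 + X`, `1`);
* `isUnit_one_sub_inv_natCast_iff ∕ isUnit_one_add_inv_natCast_iff` — for a prime-to-`p` natural `q`:
  `1 - q⁻¹ ∈ ℤ_p^×` iff `p ∤ q - 1`, `1 + q⁻¹ ∈ ℤ_p^×` iff `p ∤ q + 1` (`1 ∓ q⁻¹ = q⁻¹(q ∓ 1)`);
* `isUnit_constantCoeff_eulerFactorProduct_iff` — the augmentation of the product is a unit iff every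
  factor's is (`ℤ_p` a commutative monoid: `IsUnit.mul_iff`);
* **`multDivisibilityAt_of_thm87_of_corollary18_of_eulerCertificate_of_mu_eq_zero`** — §3 of the
  companion with the Euler-unit hypothesis replaced by the ARITHMETIC certificate on a finite set `S`
  of bad places `≠ p` containing all of them: at each split `v ∈ S`, `p ∤ q_v - 1`; at each non-split
  `v ∈ S`, `p ∤ q_v + 1` (additive places free).

So the Euler-unit certificate of a pair `(E, p)` reads: no SPLIT multiplicative `q ≠ p` with
`q ≡ 1 (mod p)` and no NON-SPLIT multiplicative `q ≠ p` with `q ≡ -1 (mod p)` (`q - a_q =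
#Ẽ_ns(𝔽_q)`), additive places being free. HONEST FRAMING: theorems only; nothing here is asserted about
any curve; item 19065 does NOT close; no census word moves; BSD is not proved by any of this.

References: [GreenbergVatsal2000] §1 pp. 8–9 (`𝒫_ℓ = P_ℓ(ℓ⁻¹γ_ℓ)`), Prop. (2.4); [Rubin1998Durham]
Thm. 6.1 (`ℓ_q(q⁻¹)`), Thm. 8.7; [SilvermanAEC2009] §C.16 (local factors `1 ∓ X`, `1`).
-/

noncomputable section

open scoped Classical NumberField

namespace Summit.BirchSwinnertonDyer.Rank1Residual.X11b

open Polynomial NumberField IsDedekindDomain WeierstrassCurve Literature.NumberTheory.EllipticCurves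
  Literature.NumberTheory.EllipticCurves.GreenbergVatsal2000

section EulerAugmentation

variable (W : WeierstrassCurve ℚ) (p : ℕ) [hp : Fact p.Prime] (v : HeightOneSpectrum (𝓞 ℚ))

/-- **`𝒫_v(0) = P_v(E, q_v⁻¹)`**: the augmentation of Greenberg–Vatsal's Euler-factor element is the
Euler factor evaluated at `q_v⁻¹ ∈ ℤ_p` (`γ_v = (1+T)^{f_v}` has constant term `1`) — Rubin's
`ℓ_q(q⁻¹)`. [cite: GreenbergVatsal2000, §1 pp. 8–9 (𝒫_ℓ = P_ℓ(ℓ⁻¹γ_ℓ))] [cite: Rubin1998Durham, Thm. 6.1 and Thm. 8.7 (ℓ_q(q⁻¹))] -/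
theorem constantCoeff_eulerFactorElement :
    PowerSeries.constantCoeff (eulerFactorElement W p v) =
      Polynomial.aeval ((Rat.HeightOneSpectrum.natGenerator v : ℤ_[p]).inv) (W.localPolynomialAt v) := by
  rw [eulerFactorElement, Polynomial.aeval_def, Polynomial.aeval_def, Polynomial.hom_eval₂]
  have hpt : PowerSeries.constantCoeff (eulerFactorPoint p v) =
      (Rat.HeightOneSpectrum.natGenerator v : ℤ_[p]).inv := by
    rw [eulerFactorPoint, frobeniusSeries, map_mul, PowerSeries.constantCoeff_C,
      PowerSeries.binomialSeries_constantCoeff, mul_one]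
  rw [hpt]
  congr 1

variable {W v} in
/-- At a place of SPLIT multiplicative reduction `𝒫_v(0) = 1 - q_v⁻¹` (`P_v = 1 - X`).
[cite: SilvermanAEC2009, §C.16 (PDF p. 390)] [cite: GreenbergVatsal2000, §1 pp. 8–9] -/
theorem constantCoeff_eulerFactorElement_of_split (hv : W.HasSplitMultiplicativeReductionAt v) :
    PowerSeries.constantCoeff (eulerFactorElement W p v) =
      1 - (Rat.HeightOneSpectrum.natGenerator v : ℤ_[p]).inv := by
  rw [constantCoeff_eulerFactorElement, localPolynomialAt_of_hasSplitMultiplicativeReductionAt hv]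
  simp

variable {W v} in
/-- At a place of NON-SPLIT multiplicative reduction `𝒫_v(0) = 1 + q_v⁻¹` (`P_v = 1 + X`).
[cite: SilvermanAEC2009, §C.16 (PDF p. 390)] [cite: GreenbergVatsal2000, §1 pp. 8–9] -/
theorem constantCoeff_eulerFactorElement_of_nonsplit (hv : W.HasMultiplicativeReductionAt v)
    (hns : ¬ W.HasSplitMultiplicativeReductionAt v) :
    PowerSeries.constantCoeff (eulerFactorElement W p v) =
      1 + (Rat.HeightOneSpectrum.natGenerator v : ℤ_[p]).inv := by
  rw [constantCoeff_eulerFactorElement,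
    localPolynomialAt_of_hasMultiplicativeReductionAt_of_not_hasSplitMultiplicativeReductionAt hv hns]
  simp

variable {W v} in
/-- At a place of ADDITIVE reduction `𝒫_v(0) = 1` (`P_v = 1`): additive places never obstruct the
certificate. [cite: SilvermanAEC2009, §C.16 (PDF p. 390)] [cite: GreenbergVatsal2000, §1 pp. 8–9] -/
theorem constantCoeff_eulerFactorElement_of_additive (hv : W.HasAdditiveReductionAt v) :
    PowerSeries.constantCoeff (eulerFactorElement W p v) = 1 := by
  rw [constantCoeff_eulerFactorElement, localPolynomialAt_of_hasAdditiveReductionAt hv]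
  simp

omit hp in
/-- For `q` prime to `p`: `1 - q⁻¹ = q⁻¹ · (q - 1)` in `ℤ_p`. [folklore] -/
theorem one_sub_inv_natCast_eq [Fact p.Prime] {q : ℕ} (hq : p.Coprime q) :
    (1 : ℤ_[p]) - (q : ℤ_[p]).inv = (q : ℤ_[p]).inv * ((q : ℤ_[p]) - 1) := by
  have h1 : (q : ℤ_[p]).inv * (q : ℤ_[p]) = 1 :=
    PadicInt.inv_mul (PadicInt.norm_natCast_eq_one_iff.mpr hq)
  rw [mul_sub, h1, mul_one]

omit hp in
/-- For `q` prime to `p`: `1 + q⁻¹ = q⁻¹ · (q + 1)` in `ℤ_p`. [folklore] -/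
theorem one_add_inv_natCast_eq [Fact p.Prime] {q : ℕ} (hq : p.Coprime q) :
    (1 : ℤ_[p]) + (q : ℤ_[p]).inv = (q : ℤ_[p]).inv * ((q : ℤ_[p]) + 1) := by
  have h1 : (q : ℤ_[p]).inv * (q : ℤ_[p]) = 1 :=
    PadicInt.inv_mul (PadicInt.norm_natCast_eq_one_iff.mpr hq)
  rw [mul_add, h1, mul_one]

omit hp in
/-- An integer is a unit of `ℤ_p` iff `p` does not divide it. [folklore] -/
theorem isUnit_intCast_iff_not_dvd [Fact p.Prime] (k : ℤ) : IsUnit (k : ℤ_[p]) ↔ ¬ (p : ℤ) ∣ k := by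
  rw [PadicInt.isUnit_iff, ← PadicInt.norm_int_lt_one_iff_dvd]
  constructor
  · intro h hlt
    exact absurd h (ne_of_lt hlt)
  · intro h
    exact le_antisymm (PadicInt.norm_le_one _) (not_lt.mp h)

omit hp in
/-- **`1 - q⁻¹ ∈ ℤ_p^×` iff `p ∤ q - 1`** (`q` prime to `p`): the SPLIT multiplicative criterion
(`𝒫_v(0) = 1 - q_v⁻¹`, `q_v - 1 = #Ẽ_ns(𝔽_{q_v})`). [folklore] -/
theorem isUnit_one_sub_inv_natCast_iff [Fact p.Prime] {q : ℕ} (hq : p.Coprime q) :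
    IsUnit ((1 : ℤ_[p]) - (q : ℤ_[p]).inv) ↔ ¬ (p : ℤ) ∣ (q : ℤ) - 1 := by
  have hqu : IsUnit ((q : ℤ_[p]).inv) :=
    IsUnit.of_mul_eq_one _ (PadicInt.inv_mul (PadicInt.norm_natCast_eq_one_iff.mpr hq))
  rw [one_sub_inv_natCast_eq p hq, IsUnit.mul_iff, and_iff_right hqu,
    show ((q : ℤ_[p]) - 1) = (((q : ℤ) - 1 : ℤ) : ℤ_[p]) by push_cast; ring,
    isUnit_intCast_iff_not_dvd]

omit hp in
/-- **`1 + q⁻¹ ∈ ℤ_p^×` iff `p ∤ q + 1`** (`q` prime to `p`): the NON-SPLIT multiplicative criterion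
(`𝒫_v(0) = 1 + q_v⁻¹`, `q_v + 1 = #Ẽ_ns(𝔽_{q_v})`). [folklore] -/
theorem isUnit_one_add_inv_natCast_iff [Fact p.Prime] {q : ℕ} (hq : p.Coprime q) :
    IsUnit ((1 : ℤ_[p]) + (q : ℤ_[p]).inv) ↔ ¬ (p : ℤ) ∣ (q : ℤ) + 1 := by
  have hqu : IsUnit ((q : ℤ_[p]).inv) :=
    IsUnit.of_mul_eq_one _ (PadicInt.inv_mul (PadicInt.norm_natCast_eq_one_iff.mpr hq))
  rw [one_add_inv_natCast_eq p hq, IsUnit.mul_iff, and_iff_right hqu,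
    show ((q : ℤ_[p]) + 1) = (((q : ℤ) + 1 : ℤ) : ℤ_[p]) by push_cast; ring,
    isUnit_intCast_iff_not_dvd]

/-- **The augmentation of the Euler product is a unit iff each factor's is** (`constantCoeff` is a ring
map and `ℤ_p` is commutative). [cite: GreenbergVatsal2000, §1 p. 9 (definition of L_{Σ₀}(E/ℚ,T))] -/
theorem isUnit_constantCoeff_eulerFactorProduct_iff (S : Finset (HeightOneSpectrum (𝓞 ℚ))) :
    IsUnit (PowerSeries.constantCoeff (eulerFactorProduct W p S)) ↔
      ∀ v ∈ S, IsUnit (PowerSeries.constantCoeff (eulerFactorElement W p v)) := by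
  rw [eulerFactorProduct, map_prod]
  exact IsUnit.prod_iff

end EulerAugmentation

/-! ### The arithmetic form of the Euler-unit certificate, plugged into the companion's §3 -/

section Certificate

open CongruenceSubgroup Literature.NumberTheory.EllipticCurves.ModularForms
  Literature.NumberTheory.EllipticCurves.Rank1Residual

/-- **x11c's typed divisibility at `(W, p)`, `p ≠ 2` multiplicative, from Rubin 1998 Thm. 8.7 + Wuthrich
2014 Cor. 18 + the ARITHMETIC Euler certificate + `μ = 0`.** The certificate: a finite set `S` of places
of bad reduction `≠ p` containing every bad place `≠ p` (`hS`, `hSp`, `hSbad`) such that at every split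
multiplicative `v ∈ S`, `p ∤ q_v - 1` (`hsplit`) and at every non-split multiplicative `v ∈ S`,
`p ∤ q_v + 1` (`hnonsplit`) — then `(∏_{v∈S} 𝒫_v)(0) ∈ ℤ_p^×` by §`EulerAugmentation`, and the
companion's `multDivisibilityAt_of_thm87_of_corollary18_of_eulerUnit_of_mu_eq_zero` applies. CONDITIONAL on
the two named facts (`h87`, `h18`) and on `μ(X(E/ℚ_∞)) = 0` for every cyclotomic dual datum (`hμ`,
hypothesis shape — rung K6's object); nothing asserted about any particular curve.
[cite: Rubin1998Durham, Thm. 8.7 with Thm. 6.1] [cite: Wuthrich2014, Cor. 18 (p. 398)]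
[cite: GreenbergVatsal2000, §1 pp. 8–9 (𝒫_ℓ(0) = P_ℓ(ℓ⁻¹))] [cite: GreenbergLNM1716, §1 Conj. 1.11 (shape of μ = 0)] -/
theorem multDivisibilityAt_of_thm87_of_corollary18_of_eulerCertificate_of_mu_eq_zero
    (h87 : Rubin1998.thm87_charIdeal_dvd_imprimitive_multiplicative)
    (h18 : Wuthrich2014.corollary18_padicLFunction_mem_iwasawaAlgebra_multiplicative)
    (W : WeierstrassCurve ℚ) [W.IsElliptic] [W.IsGloballyMinimal] (p : ℕ) [Fact p.Prime]
    (hp : p ≠ 2) (hmult : W.HasMultiplicativeReductionAtPrime p)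
    (S : Finset (HeightOneSpectrum (𝓞 ℚ)))
    (hS : ∀ v : HeightOneSpectrum (𝓞 ℚ), ¬ W.HasGoodReductionAt v →
      Rat.HeightOneSpectrum.natGenerator v ≠ p → v ∈ S)
    (hSp : ∀ v ∈ S, Rat.HeightOneSpectrum.natGenerator v ≠ p)
    (hSbad : ∀ v ∈ S, W.HasMultiplicativeReductionAt v ∨ W.HasAdditiveReductionAt v)
    (hsplit : ∀ v ∈ S, W.HasSplitMultiplicativeReductionAt v →
      ¬ (p : ℤ) ∣ (Rat.HeightOneSpectrum.natGenerator v : ℤ) - 1)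
    (hnonsplit : ∀ v ∈ S, W.HasMultiplicativeReductionAt v → ¬ W.HasSplitMultiplicativeReductionAt v →
      ¬ (p : ℤ) ∣ (Rat.HeightOneSpectrum.natGenerator v : ℤ) + 1)
    (hμ : ∀ (κ : ZpExtension ℚ p) (γ : Field.absoluteGaloisGroup ℚ),
      κ.IsCyclotomic → κ.IsTopGenerator γ → IsCyclotomicVariable p γ →
      ∀ D : W.SelmerDualData κ γ, D.mu = 0) :
    MultDivisibilityAt W p := by
  refine multDivisibilityAt_of_thm87_of_corollary18_of_eulerUnit_of_mu_eq_zero h87 h18 W p hp hmult S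
    hS hSp ?_ hμ
  rw [isUnit_constantCoeff_eulerFactorProduct_iff]
  intro v hv
  have hcop : p.Coprime (Rat.HeightOneSpectrum.natGenerator v) :=
    (Nat.coprime_primes (Fact.out : p.Prime) (Rat.HeightOneSpectrum.prime_natGenerator v)).mpr
      (Ne.symm (hSp v hv))
  rcases hSbad v hv with hm | ha
  · by_cases hs : W.HasSplitMultiplicativeReductionAt v
    · rw [constantCoeff_eulerFactorElement_of_split p hs, isUnit_one_sub_inv_natCast_iff p hcop]
      exact hsplit v hv hs
    · rw [constantCoeff_eulerFactorElement_of_nonsplit p hm hs, isUnit_one_add_inv_natCast_iff p hcop]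
      exact hnonsplit v hv hm hs
  · rw [constantCoeff_eulerFactorElement_of_additive p ha]
    exact isUnit_one

end Certificate

end Summit.BirchSwinnertonDyer.Rank1Residual.X11b

end
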